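import Literature.NumberTheory.Transcendental.SemialgebraicCubicalChain
import Literature.NumberTheory.Transcendental.KZLogCalculusProofs
import Literature.NumberTheory.Transcendental.KZDominatedFamilyRelations
import Summits.KontsevichZagierPeriods.KontsevichZagierPeriods.Theorems.LinRedNormalFormDihedralNormalFormStubBoundedStokesMove
import Summits.KontsevichZagierPeriods.KontsevichZagierPeriods.Theorems.LinRedNormalFormDihedralNormalFormStubBvStokes

/-!
# Route CobordismMove — `CobordismInvariance`, part 1: Stokes along one Nash cell inside the KZ rules

Problem `KontsevichZagierPeriods`, route `CobordismMove`, support item stmt-KontsevichZagierPeriods-6762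
(`CobordismInvariance`: homologous Nash cycles give KZ-equivalent representations of a closed form).
This file proves the cell-level engine in the vocabulary of
`Literature/NumberTheory/Transcendental/SemialgebraicCubicalChain.lean`:

* `faceCoeff`-lemmas — the coefficients `A_j(y) = ω(c y)(∂_{j.succAbove 0} c(y), …)` of the pulled
  back form `c^*ω = Σ_j A_j dt_0 ∧ ⋯ ^j ⋯ ∧ dt_d` along a `C¹` `ℚ`-semialgebraic `(d+1)`-cell `c`
  (`NashCubeMap (d+1) N`): `ℚ`-semialgebraic and continuous on the closed cube, differentiable on the
  open cube when `c` is `C²` there, and their signed divergence `Σ_j (−1)^j ∂_j A_j` is the density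
  of `c^*(dω)` (Mathlib's `extDeriv_pullback` + `extDeriv_apply`), hence `0` when `ω` is closed
  along `c`;
* `chainRep_boundary_of_mem_relations` — **Stokes on a cell is a KZ relation**: if `ω` has
  `ℚ`-semialgebraic coefficients and is differentiable on an open set `S ⊇ c([0,1]^{d+1})`, `c` is
  `C²` on the open cube and `c^*(dω) = 0` there, then
  `KZ.chainRep (∂ c) ω = Σ_j (−1)^j ([c.face j 1] − [c.face j 0]) ∈ KZ.relations`.
  The moves are supplied by the tree's divergence theorem on the open cube
  (`TameBVStokes.stub_boundedStokesMove stub_bvStokes`, route `LinRedNormalForm`) applied to the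
  field `h_j = (−1)^j A_j`; the closed-cube face representations of `KZ.chainRep` are matched with the
  open-cube faces of the engine by the null boundary of the cube (rule 1a) and sign bookkeeping
  (rule 1b).

Sources: M. Spivak, *Calculus on Manifolds* (1965), Thm. 4-13 (Stokes on chains);
M. Kontsevich, D. Zagier, *Periods* (2001), §1.2, rule (3). No definition, no named fact.
-/

noncomputable section

open MeasureTheory Set Function
open Literature.NumberTheory.Transcendental
open Literature.ModelTheory.ExponentialFields (IsSemialgebraic)

namespace Summit.KontsevichZagierPeriods.CobordismMove.CobordismInvariance

variable {d N : ℕ}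

/-! ## The coefficients of the pulled-back form -/

section Coeff

variable {S : Set (Fin N → ℝ)} {ω : (Fin N → ℝ) → (Fin N → ℝ) [⋀^Fin d]→L[ℝ] ℝ}
  {c : NashCubeMap (d + 1) N} {A : Fin (d + 1) → (Fin (d + 1) → ℝ) → ℝ}

/-- The coefficient `A_j` of the pulled-back form is the pulled-back form
`(c^*ω)_y = (ω (c y)).compContinuousLinearMap (fderiv ℝ c y)` evaluated on the standard basis with
`e_j` removed. [cite: Spivak1965, Ch. 4] -/
theorem faceCoeff_eq_compContinuousLinearMap
    (hA : ∀ j y, A j y = ω (c y) fun i => fderiv ℝ c y (Pi.single (j.succAbove i) 1))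
    (j : Fin (d + 1)) (y : Fin (d + 1) → ℝ) :
    A j y = (ω (c y)).compContinuousLinearMap (fderiv ℝ c y)
      (j.removeNth fun i => (Pi.single i (1 : ℝ) : Fin (d + 1) → ℝ)) := by
  rw [hA, ContinuousAlternatingMap.compContinuousLinearMap_apply]
  rfl

/-- Coordinate expansion of the coefficient `A_j` (multilinearity):
`A_j(y) = Σ_v (Π_i ∂_{j.succAbove i} c_{v i}(y)) · ω(c y)(e_{v 0}, …)`. [cite: Spivak1965, Ch. 4] -/
theorem faceCoeff_eq_sum
    (hA : ∀ j y, A j y = ω (c y) fun i => fderiv ℝ c y (Pi.single (j.succAbove i) 1))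
    (j : Fin (d + 1)) (y : Fin (d + 1) → ℝ) :
    A j y = ∑ v : Fin d → Fin N,
      (∏ i, fderiv ℝ c y (Pi.single (j.succAbove i) 1) (v i)) *
        ω (c y) (fun i => Pi.single (v i) 1) := by
  rw [hA]
  have h : (fun i => fderiv ℝ c y (Pi.single (j.succAbove i) 1)) = fun i =>
      ∑ l : Fin N, fderiv ℝ c y (Pi.single (j.succAbove i) 1) l •
        (Pi.single l (1 : ℝ) : Fin N → ℝ) :=
    funext fun i => eq_sum_smul_single _
  rw [h, ContinuousAlternatingMap.map_sum]
  refine Finset.sum_congr rfl fun v _ => ?_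
  rw [ContinuousAlternatingMap.map_smul_univ, smul_eq_mul]

/-- **Semialgebraicity** of the coefficients `A_j` on the closed cube: a polynomial in the
semialgebraic partials `∂_i c_l` and the composites `(x ↦ ω x e_v) ∘ c`.
[cite: BochnakCosteRoy1998, Prop. 2.2.6] -/
theorem isSemialgebraicFunOn_faceCoeff (hω : IsSemialgebraicFormOn S ω)
    (hcS : MapsTo c (closedUnitCube (d + 1)) S)
    (hA : ∀ j y, A j y = ω (c y) fun i => fderiv ℝ c y (Pi.single (j.succAbove i) 1))
    (j : Fin (d + 1)) : IsSemialgebraicFunOn ℚ (closedUnitCube (d + 1)) (A j) := by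
  have h : A j = fun y => ∑ v : Fin d → Fin N,
      (∏ i, fderiv ℝ c y (Pi.single (j.succAbove i) 1) (v i)) *
        ω (c y) (fun i => Pi.single (v i) 1) :=
    funext (faceCoeff_eq_sum hA j)
  rw [h]
  refine isSemialgebraicFunOn_finsetSum _ isSemialgebraic_closedUnitCube fun v _ => ?_
  have hprod : IsSemialgebraicFunOn ℚ (closedUnitCube (d + 1))
      fun y => ∏ i, fderiv ℝ c y (Pi.single (j.succAbove i) 1) (v i) :=
    isSemialgebraicFunOn_finsetProd _ isSemialgebraic_closedUnitCube
      fun i _ => c.isSemialgebraicFunOn_fderiv (j.succAbove i) (v i)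
  have hcomp : IsSemialgebraicFunOn ℚ (closedUnitCube (d + 1))
      ((fun x => ω x fun i => Pi.single (v i) 1) ∘ c) :=
    IsSemialgebraicFunOn.comp_isSemialgebraicMapOn_holds (hω v) c.isSemialgebraicMapOn hcS
  exact (IsSemialgebraicFunOn.mul_holds hprod hcomp).congr fun t _ => rfl

/-- **Continuity** of the coefficients `A_j` on the closed cube (`c` is `C¹` near the closed cube,
the coefficients of `ω` are continuous on `S`). [cite: Spivak1965, Ch. 4] -/
theorem continuousOn_faceCoeff
    (hωc : ∀ v : Fin d → Fin N, ContinuousOn (fun x => ω x fun i => Pi.single (v i) 1) S)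
    (hcS : MapsTo c (closedUnitCube (d + 1)) S)
    (hA : ∀ j y, A j y = ω (c y) fun i => fderiv ℝ c y (Pi.single (j.succAbove i) 1))
    (j : Fin (d + 1)) : ContinuousOn (A j) (closedUnitCube (d + 1)) := by
  have h : A j = fun y => ∑ v : Fin d → Fin N,
      (∏ i, fderiv ℝ c y (Pi.single (j.succAbove i) 1) (v i)) *
        ω (c y) (fun i => Pi.single (v i) 1) :=
    funext (faceCoeff_eq_sum hA j)
  rw [h]
  obtain ⟨U, hU, hsub, hcU⟩ := c.exists_contDiffOn
  have hD : ContinuousOn (fderiv ℝ c) U := hcU.continuousOn_fderiv_of_isOpen hU le_rfl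
  refine continuousOn_finsetSum _ fun v _ => ContinuousOn.mul ?_ ?_
  · refine continuousOn_finsetProd _ fun i _ => ?_
    have h1 : ContinuousOn (fun y => fderiv ℝ c y (Pi.single (j.succAbove i) 1))
        (closedUnitCube (d + 1)) :=
      ((continuous_eval_const (Pi.single (j.succAbove i) (1 : ℝ) : Fin (d + 1) → ℝ)).comp_continuousOn
        hD).mono hsub
    exact (continuous_apply (v i)).comp_continuousOn h1
  · exact (hωc v).comp c.continuousOn hcS

/-- The coefficients of a differentiable form are continuous. [folklore] -/
theorem continuousOn_apply_of_differentiableOn (hωd : DifferentiableOn ℝ ω S) (v : Fin d → Fin N) :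
    ContinuousOn (fun x => ω x fun i => Pi.single (v i) 1) S :=
  (continuous_eval_const (fun i => Pi.single (v i) (1 : ℝ) : Fin d → Fin N → ℝ)).comp_continuousOn
    hωd.continuousOn

/-- **Differentiability** of the coefficients `A_j` at the points of the open cube, when `c` is
`C²` on the open cube and `ω` is differentiable on the open set `S`. [folklore] -/
theorem differentiableAt_faceCoeff (hSo : IsOpen S) (hωd : DifferentiableOn ℝ ω S)
    (hcS : MapsTo c (closedUnitCube (d + 1)) S) (hc2 : ContDiffOn ℝ 2 c (openUnitCube (d + 1)))
    (hA : ∀ j y, A j y = ω (c y) fun i => fderiv ℝ c y (Pi.single (j.succAbove i) 1))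
    (j : Fin (d + 1)) {y : Fin (d + 1) → ℝ} (hy : y ∈ openUnitCube (d + 1)) :
    DifferentiableAt ℝ (A j) y := by
  have h : A j = fun y => (ω (c y)).compContinuousLinearMap (fderiv ℝ c y)
      (j.removeNth fun i => (Pi.single i (1 : ℝ) : Fin (d + 1) → ℝ)) :=
    funext (faceCoeff_eq_compContinuousLinearMap hA j)
  rw [h]
  have hyc : y ∈ closedUnitCube (d + 1) := openUnitCube_subset_closedUnitCube hy
  have hω : DifferentiableAt ℝ ω (c y) := hωd.differentiableAt (hSo.mem_nhds (hcS hyc))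
  have hc1 : DifferentiableAt ℝ c y := c.differentiableAt hyc
  have hDc : DifferentiableAt ℝ (fderiv ℝ c) y :=
    ((hc2.fderiv_of_isOpen isOpen_openUnitCube le_rfl).differentiableOn one_ne_zero).differentiableAt
      (isOpen_openUnitCube.mem_nhds hy)
  have hΩ : DifferentiableAt ℝ (fun y => (ω (c y)).compContinuousLinearMap (fderiv ℝ c y)) y :=
    (hω.comp y hc1).continuousAlternatingMapCompContinuousLinearMap hDc
  exact hΩ.continuousAlternatingMap_apply fun _ => differentiableAt_const _

/-- **The signed divergence of the coefficients is the density of `c^*(dω)`**: on the open cube,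
`Σ_j (−1)^j ∂_j A_j (y) = (dω)(c y)(∂_0 c(y), …, ∂_d c(y)) = pullbackDensity c (extDeriv ω) y`
(`d(c^*ω) = c^*(dω)`, Mathlib `extDeriv_pullback`, and the coordinate formula `extDeriv_apply`).
[cite: Spivak1965, Thm. 4-10] -/
theorem sum_fderiv_faceCoeff_eq_pullbackDensity_extDeriv (hSo : IsOpen S)
    (hωd : DifferentiableOn ℝ ω S) (hcS : MapsTo c (closedUnitCube (d + 1)) S)
    (hc2 : ContDiffOn ℝ 2 c (openUnitCube (d + 1)))
    (hA : ∀ j y, A j y = ω (c y) fun i => fderiv ℝ c y (Pi.single (j.succAbove i) 1))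
    {y : Fin (d + 1) → ℝ} (hy : y ∈ openUnitCube (d + 1)) :
    ∑ j : Fin (d + 1), (-1 : ℝ) ^ (j : ℕ) * fderiv ℝ (A j) y (Pi.single j 1) =
      pullbackDensity c (extDeriv ω) y := by
  set e : Fin (d + 1) → (Fin (d + 1) → ℝ) := fun i => Pi.single i 1 with he
  set Ω : (Fin (d + 1) → ℝ) → (Fin (d + 1) → ℝ) [⋀^Fin d]→L[ℝ] ℝ :=
    fun y => (ω (c y)).compContinuousLinearMap (fderiv ℝ c y) with hΩdef
  have hyc : y ∈ closedUnitCube (d + 1) := openUnitCube_subset_closedUnitCube hy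
  have hω : DifferentiableAt ℝ ω (c y) := hωd.differentiableAt (hSo.mem_nhds (hcS hyc))
  have hc1 : DifferentiableAt ℝ c y := c.differentiableAt hyc
  have hcy : ContDiffAt ℝ 2 c y := hc2.contDiffAt (isOpen_openUnitCube.mem_nhds hy)
  have hDc : DifferentiableAt ℝ (fderiv ℝ c) y :=
    ((hc2.fderiv_of_isOpen isOpen_openUnitCube le_rfl).differentiableOn one_ne_zero).differentiableAt
      (isOpen_openUnitCube.mem_nhds hy)
  have hΩ : DifferentiableAt ℝ Ω y :=
    (hω.comp y hc1).continuousAlternatingMapCompContinuousLinearMap hDc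
  -- `A j = Ω · (removeNth j e)`
  have hAj : ∀ j, A j = fun y => Ω y (j.removeNth e) := fun j =>
    funext (faceCoeff_eq_compContinuousLinearMap hA j)
  -- `d(c^*ω)(e) = Σ_j (−1)^j ∂_j A_j`
  have h1 : extDeriv Ω y e = ∑ j : Fin (d + 1), (-1 : ℝ) ^ (j : ℕ) * fderiv ℝ (A j) y (e j) := by
    rw [extDeriv_apply hΩ]
    refine Finset.sum_congr rfl fun j _ => ?_
    rw [hAj j, zsmul_eq_mul, Int.cast_pow, Int.cast_neg, Int.cast_one]
  -- `d(c^*ω) = c^*(dω)`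
  have h2 : extDeriv Ω y = (extDeriv ω (c y)).compContinuousLinearMap (fderiv ℝ c y) :=
    extDeriv_pullback hω hcy (by simp)
  rw [← h1, h2, ContinuousAlternatingMap.compContinuousLinearMap_apply, pullbackDensity_apply]
  rfl

end Coeff

/-! ## Small tools: null boundary of the cube, face representations, signs -/

/-- The boundary of the unit cube is Lebesgue-null: `[0,1]ᵈ ∖ (0,1)ᵈ` has volume `0`. [folklore] -/
theorem volume_closedUnitCube_diff_openUnitCube (d : ℕ) :
    volume (closedUnitCube d \ openUnitCube d) = 0 := by
  have hpi : openUnitCube d = Set.pi univ fun _ : Fin d => Ioo (0 : ℝ) 1 := by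
    ext x
    simp [mem_openUnitCube_iff]
  have h : (Set.pi univ fun _ : Fin d => Ioo (0 : ℝ) 1) =ᵐ[volume] Icc (0 : Fin d → ℝ) 1 := by
    rw [volume_pi]
    exact Measure.univ_pi_Ioo_ae_eq_Icc
  rw [hpi]
  exact (ae_eq_set.1 h).2

/-- An open-cube point with a coordinate in `[0,1]` inserted lies in the closed cube. [folklore] -/
theorem insertNth_mem_closedUnitCube (j : Fin (d + 1)) {t : ℝ} (ht : t ∈ Icc (0 : ℝ) 1)
    {y : Fin d → ℝ} (hy : y ∈ openUnitCube d) : Fin.insertNth j t y ∈ closedUnitCube (d + 1) := by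
  rw [mem_closedUnitCube_iff]
  intro l
  refine Fin.succAboveCases j ?_ (fun i => ?_) l
  · simpa using ht
  · simpa using Ioo_subset_Icc_self (hy i)

/-- **Face representations on the OPEN cube.** A function `g`, `ℚ`-semialgebraic and continuous on the
closed `(d+1)`-cube, restricted to the face `{x_j = ε}` and read on the open `d`-cube, is an
integral representation `[(0,1)ᵈ, g ∘ faceMap j ε]`. [cite: KontsevichZagier2001, §1.1] -/
theorem exists_openFaceRep {g : (Fin (d + 1) → ℝ) → ℝ}
    (hg : IsSemialgebraicFunOn ℚ (closedUnitCube (d + 1)) g)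
    (hgc : ContinuousOn g (closedUnitCube (d + 1))) (j : Fin (d + 1)) (ε : Fin 2) :
    ∃ f : KZ.IntegralRep d, f.domain = openUnitCube d ∧
      f.integrand = fun y => g (NashCubeMap.faceMap j ε y) := by
  have hsa : IsSemialgebraicFunOn ℚ (openUnitCube d) (g ∘ NashCubeMap.faceMap j ε) :=
    (IsSemialgebraicFunOn.comp_isSemialgebraicMapOn_holds hg (NashCubeMap.isSemialgebraicMapOn_faceMap j ε)
      (NashCubeMap.mapsTo_faceMap j ε)).mono openUnitCube_subset_closedUnitCube
      isSemialgebraic_openUnitCube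
  have hcont : ContinuousOn (g ∘ NashCubeMap.faceMap j ε) (closedUnitCube d) :=
    hgc.comp (NashCubeMap.contDiff_faceMap (n := 0) j ε).continuous.continuousOn
      (NashCubeMap.mapsTo_faceMap j ε)
  exact ⟨⟨openUnitCube d, g ∘ NashCubeMap.faceMap j ε, isSemialgebraic_openUnitCube, hsa,
    (hcont.integrableOn_compact isCompact_closedUnitCube).mono_set
      openUnitCube_subset_closedUnitCube⟩, rfl, rfl⟩

/-- **Signs are moves**: for `s = ±1`, `s • [σ, g] − [σ, s·g] ∈ KZ.relations` (rule 1b; for `s = −1`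
the derived relation `[σ, g] + [σ, −g] ∼ 0`). [cite: KontsevichZagier2001, §1.2, rule (1)] -/
theorem zsmul_of_sub_of_mem_relations {n : ℕ} {s : ℤ} (hs : s = 1 ∨ s = -1) {ρ f : KZ.IntegralRep n}
    (hd : f.domain = ρ.domain)
    (h : EqOn f.integrand (fun x => (s : ℝ) * ρ.integrand x) ρ.domain) :
    s • KZ.of ρ - KZ.of f ∈ KZ.relations := by
  rcases hs with rfl | rfl
  · rw [one_smul]
    exact KZ.of_sub_of_mem_relations_of_eqOn hd fun x hx => by rw [h hx]; simp
  · rw [neg_smul, one_smul, ← neg_add']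
    exact KZ.relations.neg_mem
      (KZ.of_add_of_mem_relations_of_eqOn_neg hd fun x hx => by rw [h hx]; simp)

/-! ## Stokes on one cell -/

section Cell

variable {S : Set (Fin N → ℝ)} {ω : (Fin N → ℝ) → (Fin N → ℝ) [⋀^Fin d]→L[ℝ] ℝ}

open Summit.KontsevichZagierPeriods.DihedralNormalForm.TameBVStokes (stub_boundedStokesMove stub_bvStokes)

/-- **Stokes along a Nash cell is a KZ relation** (the cobordism move, cell by cell). Let `ω` be a
`d`-form with `ℚ`-semialgebraic coefficients, differentiable on an open set `S ⊆ ℝᴺ`; let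
`c : [0,1]^{d+1} → ℝᴺ` be a `C¹` `ℚ`-semialgebraic cell mapping the closed cube into `S`, of class
`C²` on the open cube, along which `ω` is closed: `c^*(dω) = 0` on the open cube
(`pullbackDensity c (extDeriv ω) = 0`). Then the boundary representation
`KZ.chainRep (∂ c) ω = Σ_j (−1)^j ([cubeRep (c.face j 1) ω] − [cubeRep (c.face j 0) ω])` lies in
`KZ.relations`. Proof: the tree's divergence theorem on the open cube
(`stub_boundedStokesMove stub_bvStokes`) for the field `h_j = (−1)^j A_j`, `A_j` the coefficients of
`c^*ω`, whose divergence `Σ_j (−1)^j ∂_j A_j = c^*(dω)(e) = 0`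
(`sum_fderiv_faceCoeff_eq_pullbackDensity_extDeriv`); the bulk `[(0,1)^{d+1}, 0]` is a relation, and
each open-cube face of the engine differs from the closed-cube face `(−1)^j [cubeRep (c.face j ε) ω]`
by a null set and a sign. [cite: Spivak1965, Thm. 4-13] -/
theorem chainRep_boundary_of_mem_relations (hSo : IsOpen S) (hω : IsSemialgebraicFormOn S ω)
    (hωd : DifferentiableOn ℝ ω S) (c : NashCubeMap (d + 1) N)
    (hcS : MapsTo c (closedUnitCube (d + 1)) S) (hc2 : ContDiffOn ℝ 2 c (openUnitCube (d + 1)))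
    (hclosed : ∀ y ∈ openUnitCube (d + 1), pullbackDensity c (extDeriv ω) y = 0) :
    KZ.chainRep (SemialgebraicCubicalChain.boundary (FreeAbelianGroup.of c)) ω ∈ KZ.relations := by
  -- the coefficients `A_j` of `c^*ω` and the field `h_j = (−1)^j A_j`
  set A : Fin (d + 1) → (Fin (d + 1) → ℝ) → ℝ :=
    fun j y => ω (c y) fun i => fderiv ℝ c y (Pi.single (j.succAbove i) 1) with hAdef
  have hA : ∀ j y, A j y = ω (c y) fun i => fderiv ℝ c y (Pi.single (j.succAbove i) 1) :=
    fun _ _ => rfl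
  set h : Fin (d + 1) → (Fin (d + 1) → ℝ) → ℝ := fun j y => (-1 : ℝ) ^ (j : ℕ) * A j y with hhdef
  have hωc := fun v => continuousOn_apply_of_differentiableOn hωd v
  have hAs : ∀ j, IsSemialgebraicFunOn ℚ (closedUnitCube (d + 1)) (A j) :=
    isSemialgebraicFunOn_faceCoeff hω hcS hA
  have hAc : ∀ j, ContinuousOn (A j) (closedUnitCube (d + 1)) := continuousOn_faceCoeff hωc hcS hA
  have hAd : ∀ j, ∀ y ∈ openUnitCube (d + 1), DifferentiableAt ℝ (A j) y := fun j y hy =>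
    differentiableAt_faceCoeff hSo hωd hcS hc2 hA j hy
  have hhs : ∀ j, IsSemialgebraicFunOn ℚ (closedUnitCube (d + 1)) (h j) := fun j =>
    (IsSemialgebraicFunOn.mul_holds
      (isSemialgebraicFunOn_intCast isSemialgebraic_closedUnitCube ((-1) ^ (j : ℕ))) (hAs j)).congr
      fun y _ => by simp [h]
  have hhc : ∀ j, ContinuousOn (h j) (closedUnitCube (d + 1)) := fun j =>
    continuousOn_const.mul (hAc j)
  have hhd : ∀ j, ∀ y ∈ openUnitCube (d + 1), DifferentiableAt ℝ (h j) y := fun j y hy =>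
    (differentiableAt_const _).mul (hAd j y hy)
  -- one bound for all the `h_j` on the closed cube
  obtain ⟨C, hC⟩ : ∃ C, ∀ y ∈ closedUnitCube (d + 1), ‖fun j => A j y‖ ≤ C :=
    isCompact_closedUnitCube.exists_bound_of_continuousOn (continuousOn_pi.2 hAc)
  have hhC : ∀ j, ∀ y ∈ openUnitCube (d + 1), |h j y| ≤ C := fun j y hy => by
    have h1 : |A j y| ≤ C :=
      (norm_le_pi_norm (fun j => A j y) j).trans (hC y (openUnitCube_subset_closedUnitCube hy))
    simpa [h, abs_mul, abs_pow] using h1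
  -- fibre continuity
  have hhf : ∀ j, ∀ y ∈ openUnitCube d,
      ContinuousOn (fun t : ℝ => h j (Fin.insertNth j t y)) (Icc 0 1) := fun j y hy =>
    (hhc j).comp
      (ContinuousOn.finInsertNth (X := fun _ : Fin (d + 1) => ℝ) j continuousOn_id
        (continuousOn_const (c := y)))
      fun t ht => insertNth_mem_closedUnitCube j ht hy
  -- the divergence of `h` vanishes on the open cube (closedness of `ω` along `c`)
  have hdiv : ∀ y ∈ openUnitCube (d + 1), ∑ j, fderiv ℝ (h j) y (Pi.single j 1) = 0 := by
    intro y hy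
    rw [← hclosed y hy, ← sum_fderiv_faceCoeff_eq_pullbackDensity_extDeriv hSo hωd hcS hc2 hA hy]
    refine Finset.sum_congr rfl fun j _ => ?_
    rw [show h j = fun y => (-1 : ℝ) ^ (j : ℕ) * A j y from rfl, fderiv_const_mul (hAd j y hy)]
    rfl
  -- the bulk: the zero representation on the open cube
  obtain ⟨r, hrd, hri⟩ := KZ.exists_zeroRep (isSemialgebraic_openUnitCube (d := d + 1))
  have hr : KZ.of r ∈ KZ.relations := KZ.of_mem_relations_of_eqOn_zero r (by simp [hri, EqOn])
  -- the faces on the open cube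
  choose f₀ hf₀d hf₀i using fun j => exists_openFaceRep (hhs j) (hhc j) j 0
  choose f₁ hf₁d hf₁i using fun j => exists_openFaceRep (hhs j) (hhc j) j 1
  -- THE ENGINE
  have key : KZ.of r - ∑ j, (KZ.of (f₁ j) - KZ.of (f₀ j)) ∈ KZ.relations := by
    refine stub_boundedStokesMove stub_bvStokes d h C r f₀ f₁ (fun j => ?_) hhC hhd hhf hrd ?_
      fun j => ⟨hf₀d j, hf₁d j, fun y _ => ?_, fun y _ => ?_⟩
    · rw [← closedUnitCube_eq_setOf]; exact hhs j
    · intro y hy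
      rw [hrd] at hy
      simp only [hri, Pi.zero_apply, hdiv y hy]
    · simp [hf₀i, NashCubeMap.faceMap]
    · simp [hf₁i, NashCubeMap.faceMap]
  have hfaces : ∑ j, (KZ.of (f₁ j) - KZ.of (f₀ j)) ∈ KZ.relations := by
    have := KZ.relations.sub_mem hr key
    rwa [sub_sub_cancel] at this
  -- matching the engine's open faces with the closed faces of `chainRep (∂ c) ω`
  have hmatch : ∀ (j : Fin (d + 1)) (ε : Fin 2) (f : KZ.IntegralRep d), f.domain = openUnitCube d →
      (f.integrand = fun y => h j (NashCubeMap.faceMap j ε y)) →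
      (-1 : ℤ) ^ (j : ℕ) • KZ.of (KZ.cubeRep (c.face j ε) ω) - KZ.of f ∈ KZ.relations := by
    intro j ε f hfd hfi
    have hdef : KZ.CubeRepDefined (c.face j ε) ω :=
      KZ.cubeRepDefined_of_continuousOn hω hωc (NashCubeMap.mapsTo_face hcS j ε)
    set ρ := KZ.cubeRep (c.face j ε) ω with hρ
    have hρd : ρ.domain = closedUnitCube d := KZ.cubeRep_domain _ _
    have hsub : openUnitCube d ⊆ ρ.domain := hρd ▸ openUnitCube_subset_closedUnitCube
    have h1 : KZ.of ρ - KZ.of (ρ.restrict _ isSemialgebraic_openUnitCube hsub) ∈ KZ.relations :=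
      KZ.IntegralRep.of_sub_of_restrict_mem_relations ρ isSemialgebraic_openUnitCube hsub
        (by rw [hρd]; exact volume_closedUnitCube_diff_openUnitCube d)
    have h2 : (-1 : ℤ) ^ (j : ℕ) • KZ.of (ρ.restrict _ isSemialgebraic_openUnitCube hsub) - KZ.of f ∈
        KZ.relations := by
      refine zsmul_of_sub_of_mem_relations (neg_one_pow_eq_or ℤ j) (by rw [hfd]; rfl) ?_
      intro y hy
      change y ∈ openUnitCube d at hy
      rw [hfi, KZ.IntegralRep.integrand_restrict, KZ.cubeRep_integrand hdef]
      beta_reduce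
      rw [pullbackDensity_face c j ε ω (openUnitCube_subset_closedUnitCube hy)]
      simp [h, A]
    have : (-1 : ℤ) ^ (j : ℕ) • KZ.of ρ - KZ.of f =
        (-1 : ℤ) ^ (j : ℕ) • (KZ.of ρ - KZ.of (ρ.restrict _ isSemialgebraic_openUnitCube hsub)) +
          ((-1 : ℤ) ^ (j : ℕ) • KZ.of (ρ.restrict _ isSemialgebraic_openUnitCube hsub) - KZ.of f) := by
      rw [smul_sub]; abel
    rw [this]
    exact KZ.relations.add_mem (KZ.relations.zsmul_mem h1 _) h2
  -- assembling
  have hsum : KZ.chainRep (SemialgebraicCubicalChain.boundary (FreeAbelianGroup.of c)) ω -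
      ∑ j, (KZ.of (f₁ j) - KZ.of (f₀ j)) ∈ KZ.relations := by
    rw [KZ.chainRep_boundary_of, ← Finset.sum_sub_distrib]
    refine sum_mem fun j _ => ?_
    have : (-1 : ℤ) ^ (j : ℕ) • (KZ.of (KZ.cubeRep (c.face j 1) ω) - KZ.of (KZ.cubeRep (c.face j 0) ω)) -
        (KZ.of (f₁ j) - KZ.of (f₀ j)) =
        ((-1 : ℤ) ^ (j : ℕ) • KZ.of (KZ.cubeRep (c.face j 1) ω) - KZ.of (f₁ j)) -
          ((-1 : ℤ) ^ (j : ℕ) • KZ.of (KZ.cubeRep (c.face j 0) ω) - KZ.of (f₀ j)) := by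
      rw [smul_sub]; abel
    rw [this]
    exact KZ.relations.sub_mem (hmatch j 1 (f₁ j) (hf₁d j) (hf₁i j))
      (hmatch j 0 (f₀ j) (hf₀d j) (hf₀i j))
  have := KZ.relations.add_mem hsum hfaces
  rwa [sub_add_cancel] at this

end Cell

end Summit.KontsevichZagierPeriods.CobordismMove.CobordismInvariance
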